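import Summits.NavierStokesRegularity.NavierStokesRegularity.Theorems.TerminalTraceTypeITraceScarL3LogMeanCalculus

/-!
# ROUND-28 calculus plate, part 2 — the log-mean form of the Ghidaglia calculus and the frequency CEILING

Sequel to `TerminalTraceTypeITraceScarL3LogMeanCalculus` (`one_le_logMeanExponent_of_frequencyODE`, the
variable-exponent Agmon–Nirenberg/Ghidaglia threshold).  This part: (1) `one_le_logMean_of_identities` — the
identity package of the cut-off velocity (floor, `E/D` identities, shell bounds, drift Cauchy–Schwarz bound with
`β(s)² ≤ 2p(s)/(−s)`) plus extinction forces the log-window mean bound `q ≥ 1`; (2) `frequency_logMean_le_quarter`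
— floor + energy inequality give the self-similar CEILING on every primitive of the Dirichlet quotient.
(Split from nsreg-p2 g29's t28 plate file at the gate's 400-line limit; statements and proofs verbatim.)

WHAT THIS IS NOT: pure real analysis; no statement about Navier–Stokes.  [folklore; Agmon–Nirenberg 1967;
Ghidaglia 1986]
-/

open Set Filter Topology

set_option linter.dupNamespace false

namespace Summit.NavierStokesRegularity.NavierStokesRegularity.Theorems.TypeITraceScarL3


/-- **Ghidaglia calculus, log-mean form.**  The identity package of the cut-off velocity with the
instantaneous rate bound `β(s)² ≤ 2p(s)/(−s)` (i.e. `p(s) = (−s)·sup|V(s,·)|²/2`) and log-window means of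
`p` at most `q` (slack `K₀`) forces `1 ≤ q`.  Same derivation as `two_le_rateSq_of_identities`, ending in
`one_le_logMeanExponent_of_frequencyODE`. -/
theorem one_le_logMean_of_identities
    {q K₀ c m₁ m₂ s₁ : ℝ} {E D Q₀ S₁ S₂ X β p P : ℝ → ℝ}
    (hs₁ : s₁ < 0) (hc : 0 < c) (hm₁ : 0 ≤ m₁) (hm₂ : 0 ≤ m₂) (hK₀ : 0 ≤ K₀)
    (hfloor : ∀ s ∈ Ioo s₁ 0, c * Real.sqrt (-s) ≤ E s)
    (hDnn : ∀ s ∈ Ioo s₁ 0, 0 ≤ D s)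
    (hCS : ∀ s ∈ Ioo s₁ 0, D s ^ 2 ≤ E s * Q₀ s)
    (hE : ∀ s ∈ Ioo s₁ 0, HasDerivAt E (-2 * D s + 2 * S₁ s) s)
    (hD : ∀ s ∈ Ioo s₁ 0, HasDerivAt D (-2 * Q₀ s + 2 * X s - 2 * S₂ s) s)
    (hS₁ : ∀ s ∈ Ioo s₁ 0, |S₁ s| ≤ m₁) (hS₂ : ∀ s ∈ Ioo s₁ 0, |S₂ s| ≤ m₂)
    (hpnn : ∀ s ∈ Ioo s₁ 0, 0 ≤ p s)
    (hP : ∀ s ∈ Ioo s₁ 0, HasDerivAt P (p s / (-s)) s)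
    (hwin : ∀ s' ∈ Ioo s₁ 0, ∀ s ∈ Ioo s₁ 0, s' ≤ s →
      P s - P s' ≤ q * Real.log ((-s') / (-s)) + K₀)
    (hβ : ∀ s ∈ Ioo s₁ 0, 0 ≤ β s ∧ β s ^ 2 ≤ 2 * p s / (-s))
    (hX : ∀ s ∈ Ioo s₁ 0,
      |X s| ≤ β s * Real.sqrt (Q₀ s - D s ^ 2 / E s) * Real.sqrt (D s))
    (hext : Tendsto E (𝓝[<] 0) (𝓝 0)) :
    1 ≤ q := by
  have hneg : ∀ s ∈ Ioo s₁ 0, 0 < -s := fun s hs => by linarith [hs.2]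
  have hsqrt : ∀ s ∈ Ioo s₁ 0, 0 < Real.sqrt (-s) := fun s hs => Real.sqrt_pos.mpr (hneg s hs)
  have hEpos : ∀ s ∈ Ioo s₁ 0, 0 < E s := fun s hs =>
    lt_of_lt_of_le (mul_pos hc (hsqrt s hs)) (hfloor s hs)
  set Λ : ℝ → ℝ := fun s => D s / E s with hΛ_def
  set Λ' : ℝ → ℝ := fun s =>
    ((-2 * Q₀ s + 2 * X s - 2 * S₂ s) * E s - D s * (-2 * D s + 2 * S₁ s)) / E s ^ 2 with hΛ'_def
  have hΛder : ∀ s ∈ Ioo s₁ 0, HasDerivAt Λ (Λ' s) s := fun s hs =>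
    (hD s hs).div (hE s hs) (hEpos s hs).ne'
  have hΛnn : ∀ s ∈ Ioo s₁ 0, 0 ≤ Λ s := fun s hs =>
    div_nonneg (hDnn s hs) (hEpos s hs).le
  have hE' : ∀ s ∈ Ioo s₁ 0,
      -2 * Λ s * E s - (2 * m₁ / c) / Real.sqrt (-s) * E s ≤ -2 * D s + 2 * S₁ s := by
    intro s hs
    have hEs := hEpos s hs
    have ht := hsqrt s hs
    have h1 : -2 * Λ s * E s = -2 * D s := by simp only [hΛ_def]; field_simp
    have h2 : -m₁ ≤ S₁ s := (abs_le.mp (hS₁ s hs)).1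
    have h3 : 2 * m₁ ≤ (2 * m₁ / c) / Real.sqrt (-s) * E s := by
      rw [div_div, div_mul_eq_mul_div, le_div_iff₀ (mul_pos hc ht)]
      have := hfloor s hs
      nlinarith
    linarith [h1, h2, h3]
  have hΛ'le : ∀ s ∈ Ioo s₁ 0,
      Λ' s ≤ (p s / (-s) + (2 * m₁ / c) / Real.sqrt (-s)) * Λ s
        + (2 * m₂ / c) / Real.sqrt (-s) := by
    intro s hs
    have hEs := hEpos s hs
    have ht := hsqrt s hs
    have hs0 := hneg s hs
    have hDs := hDnn s hs
    obtain ⟨hβ0, hβC⟩ := hβ s hs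
    set Q : ℝ := Q₀ s - D s ^ 2 / E s with hQ_def
    have hQ : 0 ≤ Q := by
      have : D s ^ 2 / E s ≤ Q₀ s := by
        rw [div_le_iff₀ hEs]; linarith [hCS s hs, mul_comm (E s) (Q₀ s)]
      simp only [hQ_def]; linarith
    have hG : -2 * Q + 2 * X s ≤ (1 / 2) * β s ^ 2 * D s :=
      ghidaglia_algebra hQ hDs (hX s hs)
    have hΛ'eq : Λ' s = (-2 * Q + 2 * X s) / E s - 2 * S₂ s / E s - 2 * Λ s * S₁ s / E s := by
      simp only [hΛ'_def, hΛ_def, hQ_def]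
      field_simp
      ring
    have p1 : (-2 * Q + 2 * X s) / E s ≤ p s / (-s) * Λ s := by
      have a1 : (-2 * Q + 2 * X s) / E s ≤ ((1 / 2) * β s ^ 2 * D s) / E s :=
        div_le_div_of_nonneg_right hG hEs.le
      have a2 : ((1 / 2) * β s ^ 2 * D s) / E s = (1 / 2) * β s ^ 2 * Λ s := by
        simp only [hΛ_def]; ring
      have a3 : (1 / 2) * β s ^ 2 * Λ s ≤ (1 / 2) * (2 * p s / (-s)) * Λ s := by
        have := hΛnn s hs
        nlinarith
      have a4 : (1 / 2) * (2 * p s / (-s)) * Λ s = p s / (-s) * Λ s := by ring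
      linarith [a1, a2, a3, a4]
    have p2 : -(2 * S₂ s / E s) ≤ (2 * m₂ / c) / Real.sqrt (-s) := by
      have a1 : -(2 * S₂ s / E s) ≤ 2 * m₂ / E s := by
        rw [neg_le, ← neg_div]
        apply div_le_div_of_nonneg_right _ hEs.le
        linarith [(abs_le.mp (hS₂ s hs)).1]
      have a2 : 2 * m₂ / E s ≤ 2 * m₂ / (c * Real.sqrt (-s)) :=
        div_le_div_of_nonneg_left (by linarith) (mul_pos hc ht) (hfloor s hs)
      have a3 : 2 * m₂ / (c * Real.sqrt (-s)) = (2 * m₂ / c) / Real.sqrt (-s) := by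
        rw [div_div]
      linarith [a1, a2, a3]
    have p3 : -(2 * Λ s * S₁ s / E s) ≤ (2 * m₁ / c) / Real.sqrt (-s) * Λ s := by
      have hΛs := hΛnn s hs
      have a1 : -(2 * Λ s * S₁ s / E s) ≤ 2 * Λ s * m₁ / E s := by
        rw [neg_le, ← neg_div]
        apply div_le_div_of_nonneg_right _ hEs.le
        have := (abs_le.mp (hS₁ s hs)).1
        nlinarith
      have a2 : 2 * Λ s * m₁ / E s ≤ 2 * Λ s * m₁ / (c * Real.sqrt (-s)) :=
        div_le_div_of_nonneg_left (by positivity) (mul_pos hc ht) (hfloor s hs)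
      have a3 : 2 * Λ s * m₁ / (c * Real.sqrt (-s)) = (2 * m₁ / c) / Real.sqrt (-s) * Λ s := by
        rw [div_div]; ring
      linarith [a1, a2, a3]
    rw [hΛ'eq]
    nlinarith [p1, p2, p3]
  exact one_le_logMeanExponent_of_frequencyODE q K₀ (2 * m₁ / c) (2 * m₂ / c) (2 * m₁ / c) s₁ E Λ
    (fun s => -2 * D s + 2 * S₁ s) Λ' p P hs₁ (by positivity) (by positivity) (by positivity) hK₀
    hEpos hΛnn hE hΛder hpnn hP hwin hE' hΛ'le hext

/-- **The frequency ceiling (calibration).**  If `E` obeys the cut-off energy inequality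
`E' ≤ −2ΛE + 2m₁` and the floor `c√(−s) ≤ E` on `]s₁,0[`, then every primitive `I` of `Λ` satisfies
`I s − I s' ≤ ¼·log((−s')/(−s)) + ½·log(E(s')/(c√(−s'))) + (2m₁/c)√(−s')` for `s' ≤ s`: the log-time
mean of `(−s)Λ(s)` is at most `¼` asymptotically (an exactly self-similar extinct profile has
`(−s)Λ(s) ≡ ¼`).  So the log-convexity method of ROUND-27/28, which needs `Λ ≤ K(−s)^{-p}` with `p < 1`
(log-mean of `(−s)Λ` equal to `0`), can only ever exclude extinction by showing that the Dirichlet-quotient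
law forbids the frequency constant to be positive — never by a contradiction between two rates.
[folklore] -/
theorem frequency_logMean_le_quarter :
    ∀ (c m₁ s₁ : ℝ) (E Λ E' I : ℝ → ℝ), s₁ < 0 → 0 < c → 0 ≤ m₁ →
      (∀ s ∈ Ioo s₁ 0, c * Real.sqrt (-s) ≤ E s) →
      (∀ s ∈ Ioo s₁ 0, HasDerivAt E (E' s) s) →
      (∀ s ∈ Ioo s₁ 0, E' s ≤ -2 * Λ s * E s + 2 * m₁) →
      (∀ s ∈ Ioo s₁ 0, HasDerivAt I (Λ s) s) →
      ∀ s' ∈ Ioo s₁ 0, ∀ s ∈ Ioo s₁ 0, s' ≤ s →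
        I s - I s' ≤ (1 / 4) * Real.log ((-s') / (-s)) +
          (1 / 2) * Real.log (E s' / (c * Real.sqrt (-s'))) + (2 * m₁ / c) * Real.sqrt (-s') := by
  intro c m₁ s₁ E Λ E' I hs₁ hc hm₁ hfloor hE hE' hI s' hs' s hs hle
  have hneg : ∀ s ∈ Ioo s₁ 0, 0 < -s := fun s hs => by linarith [hs.2]
  have hEpos : ∀ s ∈ Ioo s₁ 0, 0 < E s := fun s hs =>
    lt_of_lt_of_le (mul_pos hc (Real.sqrt_pos.mpr (hneg s hs))) (hfloor s hs)
  -- `G = 2 I + log E + (4 m₁ / c) √(-s)` is non-increasing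
  set G : ℝ → ℝ := fun s => 2 * I s + Real.log (E s) + (4 * m₁ / c) * Real.sqrt (-s) with hG_def
  have hGder : ∀ s ∈ Ioo s₁ 0, HasDerivAt G
      (2 * Λ s + E' s / E s + (4 * m₁ / c) * ((-1) / (2 * Real.sqrt (-s)))) s := by
    intro s hs
    have hs0 : -s ≠ 0 := (hneg s hs).ne'
    have h1 : HasDerivAt (fun s => 2 * I s) (2 * Λ s) s := (hI s hs).const_mul 2
    have h2 : HasDerivAt (fun s => Real.log (E s)) (E' s / E s) s :=
      (hE s hs).log (hEpos s hs).ne'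
    have h3 : HasDerivAt (fun s : ℝ => (4 * m₁ / c) * Real.sqrt (-s))
        ((4 * m₁ / c) * ((-1) / (2 * Real.sqrt (-s)))) s :=
      ((hasDerivAt_neg s).sqrt hs0).const_mul _
    exact (h1.add h2).add h3
  have hGder_le : ∀ s ∈ Ioo s₁ 0,
      2 * Λ s + E' s / E s + (4 * m₁ / c) * ((-1) / (2 * Real.sqrt (-s))) ≤ 0 := by
    intro s hs
    have hs0 : 0 < -s := hneg s hs
    have hsq : 0 < Real.sqrt (-s) := Real.sqrt_pos.mpr hs0
    have hEs := hEpos s hs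
    have hfl := hfloor s hs
    -- `E'/E ≤ -2Λ + 2m₁/E ≤ -2Λ + 2m₁/(c√(-s))`
    have h1 : E' s / E s ≤ -2 * Λ s + 2 * m₁ / E s := by
      rw [div_le_iff₀ hEs]
      have := hE' s hs
      have e : (-2 * Λ s + 2 * m₁ / E s) * E s = -2 * Λ s * E s + 2 * m₁ := by
        field_simp
      linarith [e]
    have h2 : 2 * m₁ / E s ≤ 2 * m₁ / (c * Real.sqrt (-s)) :=
      div_le_div_of_nonneg_left (by positivity) (by positivity) hfl
    have h3 : (4 * m₁ / c) * ((-1) / (2 * Real.sqrt (-s))) = -(2 * m₁ / (c * Real.sqrt (-s))) := by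
      field_simp
      ring
    linarith [h1, h2, h3]
  have hGanti : G s ≤ G s' := by
    rcases eq_or_lt_of_le hle with h | h
    · rw [h]
    · have hsub : Icc s' s ⊆ Ioo s₁ 0 := fun x hx =>
        ⟨lt_of_lt_of_le hs'.1 hx.1, lt_of_le_of_lt hx.2 hs.2⟩
      have hcont : ContinuousOn G (Icc s' s) := fun x hx =>
        (hGder x (hsub hx)).continuousAt.continuousWithinAt
      have hdiff : DifferentiableOn ℝ G (interior (Icc s' s)) := by
        rw [interior_Icc]
        exact fun x hx => (hGder x (hsub (Ioo_subset_Icc_self hx))).differentiableAt.differentiableWithinAt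
      have hder : ∀ x ∈ interior (Icc s' s), deriv G x ≤ 0 := by
        rw [interior_Icc]; intro x hx
        rw [(hGder x (hsub (Ioo_subset_Icc_self hx))).deriv]
        exact hGder_le x (hsub (Ioo_subset_Icc_self hx))
      have hmv := (convex_Icc s' s).image_sub_le_mul_sub_of_deriv_le hcont hdiff hder
        s' (left_mem_Icc.mpr h.le) s (right_mem_Icc.mpr h.le) h.le
      linarith
  -- unpack `G s ≤ G s'`
  have hs0 : 0 < -s := hneg s hs
  have hs'0 : 0 < -s' := hneg s' hs'
  have hsq : 0 < Real.sqrt (-s) := Real.sqrt_pos.mpr hs0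
  have hsq' : 0 < Real.sqrt (-s') := Real.sqrt_pos.mpr hs'0
  have hlogE : Real.log (c * Real.sqrt (-s)) ≤ Real.log (E s) :=
    Real.log_le_log (by positivity) (hfloor s hs)
  -- `log E s' - log (c √(-s)) = log (E s'/(c√(-s'))) + ½ log ((-s')/(-s))`
  have hsplit : Real.log (E s') - Real.log (c * Real.sqrt (-s)) =
      Real.log (E s' / (c * Real.sqrt (-s'))) + (1 / 2) * Real.log ((-s') / (-s)) := by
    rw [Real.log_div (hEpos s' hs').ne' (by positivity), Real.log_div hs'0.ne' hs0.ne',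
      Real.log_mul hc.ne' hsq.ne', Real.log_mul hc.ne' hsq'.ne',
      Real.log_sqrt hs0.le, Real.log_sqrt hs'0.le]
    ring
  have hsqnn : 0 ≤ (4 * m₁ / c) * Real.sqrt (-s) := by positivity
  have hG1 : G s = 2 * I s + Real.log (E s) + (4 * m₁ / c) * Real.sqrt (-s) := rfl
  have hG2 : G s' = 2 * I s' + Real.log (E s') + (4 * m₁ / c) * Real.sqrt (-s') := rfl
  have h4 : (4 * m₁ / c) * Real.sqrt (-s') = 2 * ((2 * m₁ / c) * Real.sqrt (-s')) := by ring
  linarith [hGanti, hlogE, hsplit, hG1, hG2, h4]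

end Summit.NavierStokesRegularity.NavierStokesRegularity.Theorems.TypeITraceScarL3
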